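import Literature.NumberTheory.EllipticCurves.ZpExtensionCoeffTwistCores
import Literature.NumberTheory.EllipticCurves.LambdaAdicSelmerDataToEisensteinH1
import HarnessLib

/-!
# The level maps `𝔖_p(K_∞) → H¹(K, E[p^k] ⊗ A(ψ⁻¹))` of the `Λ`-adic Selmer module into the cohomology of the
# twists with GENERAL coefficients (`A = Λ/I` for the `Λ`-adic source tower, `A = A_{m,k}` for Howard's `T_𝔮`):
# independence of the auxiliary layer, compatibility with the reductions and with the CHANGE OF COEFFICIENTS
# (definitions with bodies + theorems)

Topic `NumberTheory/EllipticCurves` (sequel of `ZpExtensionCoeffTwistCores`; the generic-coefficient twin of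
`LambdaAdicSelmerDataToEisensteinH1`, D1 lineage p639748). Cell `pub/bsd-print-x9`, seat `bsd-line-x9-p2` (g3), for the
Λ-ADIC SOURCE of STUB 2 of the shared μ-item of crux stmt-BirchSwinnertonDyer-27077: the identity
«`κ₁ = levels of ctrl_m z`» of the Kolyvagin-system pushforward (x9-p1 LEAD g3 RULING 2026-08-28T16:08:30Z (q2)(d):
`one′ k = H¹(f k)(one (σ k))` must be D1's control map on `z` "BY naturality", with `f k` LITERALLY a quotient map
of coefficients).

Setting: `E = V` elliptic over a number field `K` with `E(K)[p] = 0`, `κ : ZpExtension K p` with topological generator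
`γ`, `D : V.LambdaAdicSelmerData κ γ` (`𝔖 = 𝔖_p(K_∞)`, pinned), a commutative coefficient ring `A` with `u ∈ A`,
`u^{p^J} = 1` (for `A = Λ/I`: `u = 1 + T`, `ω_J ∈ I`), and — as in the D1 road, SIGN CONVENTION `κ⁻ := κ.unitTwist (-1)`
(same layers; makes the maps `Λ`-linear) — the twists `κ⁻.coeffTwist (E[p^k]) u J hu = E[p^k] ⊗ A(χ_u)` of
`ZpExtensionCoeffTwistCores`.

* §1 **`coeffComponent D hu k n hn : D.S →+ H¹(K, E[p^k] ⊗ A(χ_u))`** `:= coresCoeff κ⁻ (Γ_n) ∘ (proj_n ·)_k`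
  (`n ≥ J`); **independent of `n`** (`coeffComponent_eq_of_le`, via `coresCoeff_coresLe` + `coresLe_proj_eq_proj`,
  uses `E(K)[p] = 0`); **`coeffComponent_eisenstein`: at `A = A_{m,k}` it IS D1's `eisensteinComponent` (`rfl`)**.
* §2 **compatibility with coefficient/module change**: for `φ : A →+* A′` with `φ u = u′` —
  `map_coeffTwistReduce_coeffComponent_of_forall_eq` (same `k`, a module map that is pointwise the identity:
  PURE CHANGE OF COEFFICIENTS `H¹(1 ⊗ φ) ∘ comp_{A} = comp_{A′}`), `map_coeffTwistReduce_coeffComponent_reduce`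
  (`k+1 → k` along an equivariant lift `t k` of `P ↦ p P`: the tower transition), and the COROLLARY
  **`map_coeffTwistReduce_coeffComponent_eq_eisensteinComponent`**: `H¹(E[p^k] ⊗ (A ↠ A_{m,k})) ∘ comp_A =
  eisensteinComponent D hm k` — the source-to-target level map of the pushforward IS D1's control component,
  hence (`proj_toEisensteinH1`) the `k`-th projection of `toEisensteinH1 z`.
DEFINITIONS WITH BODIES + theorems; no named fact, no instance, no notation, no `sorry`. Not here: the
`Λ`-linearity of `coeffComponent` for `A = Λ/I` (sequel), the source `CoeffTowerSetting`/`AdicTower` assembly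
(lit/D1 typing), the pushforward (LEAD). BSD is not proved by any of this.

References: [Howard2004HeegnerKolyvagin] B. Howard, Compositio Math. 140 (2004), §2.2, Def. 2.2.3, Rem. 1.2.4, proof of
Thm. 2.2.10 (arXiv Thm. 3.2.10, p0017 L78–81); [PerrinRiou1987BSMF] §0 p. 402; [MazurRubinMemoirs2004] §5.3;
[SerreGaloisCohomology1997] I §2.4–§2.5; [Washington1997] §13.1–§13.2.
-/

noncomputable section

open scoped Topology Classical ContRepresentation
open Field CategoryTheory

universe u

namespace WeierstrassCurve.LambdaAdicSelmerData

open Literature.NumberTheory.EllipticCurves Literature.NumberTheory.GaloisRepresentations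
open Literature.NumberTheory.EllipticCurves.ZpExtension (eisensteinLevel)

variable {K : Type u} [Field K] [NumberField K] {V : WeierstrassCurve K} [V.IsElliptic] {p : ℕ} [hp : Fact p.Prime]
  {κ : ZpExtension K p} {γ : absoluteGaloisGroup K} (D : V.LambdaAdicSelmerData κ γ)
  {A : Type} [CommRing A] {u : A} {J : ℕ} (hu : u ^ (p ^ J) = 1)

/-! ## §1 The level components with general coefficients -/

omit [NumberField K] [V.IsElliptic] in
/-- `Γ_n ≤ Γ⁻_J` for `n ≥ J`: the layers of `κ⁻ = κ.unitTwist (-1)` are those of `κ`. [cite: Washington1997, §13.1] -/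
theorem layerSubgroup_le_unitTwist_layerSubgroup_of_le {J n : ℕ} (hn : J ≤ n) :
    κ.layerSubgroup n ≤ (κ.unitTwist (-1)).layerSubgroup J := by
  rw [ZpExtension.layerSubgroup_unitTwist]
  exact κ.layerSubgroup_antitone hn

/-- **The level-`(n, k)` component with coefficients in `A`**: `s ↦ cor_{Γ_n}^{Γ_K}(1 ⊗ (proj_n s)_k) ∈
H¹(K, E[p^k] ⊗ A(χ_u))` at the inverse extension `κ⁻` (`n ≥ J`). For `A = Λ/I` these are the level maps of
`𝔖 ≅ H¹(K, 𝐓) → H¹(K, 𝐓/I𝐓 ⊗ ℤ/p^k)`; for `A = A_{m,k}` this is D1's `eisensteinComponent` (`coeffComponent_eisenstein`).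
[cite: Howard2004HeegnerKolyvagin, §2.2 (𝔖 ≅ H¹(K, 𝐓)) and Rem. 1.2.4] [cite: SerreGaloisCohomology1997, I §2.5 (b)] -/
def coeffComponent (k n : ℕ) (hn : J ≤ n) :
    D.S →+ galoisCohomology ((κ.unitTwist (-1)).coeffTwist (V.torsionGaloisModule ((p : ℤ) ^ k)) u J hu) 1 :=
  haveI := κ.fintypeQuotientLayer n
  ((κ.unitTwist (-1)).coresCoeff (V.torsionGaloisModule ((p : ℤ) ^ k)) hu (κ.layerSubgroup n)
      (layerSubgroup_le_unitTwist_layerSubgroup_of_le hn) (κ.isOpen_layerSubgroup n)).comp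
    ((Pi.evalAddMonoidHom (fun j : ℕ ↦ V.torsionH1Over ((p : ℤ) ^ j) (κ.layerSubgroup n)) k).comp (D.proj n))

omit [V.IsElliptic] in
/-- Unfolding `coeffComponent` (for ANY finiteness structure on `Γ_K ⧸ Γ_n`). [cite: Howard2004HeegnerKolyvagin, §2.2] -/
theorem coeffComponent_apply (k n : ℕ) (hn : J ≤ n) [hF : Fintype (absoluteGaloisGroup K ⧸ κ.layerSubgroup n)]
    (s : D.S) :
    D.coeffComponent hu k n hn s =
      (κ.unitTwist (-1)).coresCoeff (V.torsionGaloisModule ((p : ℤ) ^ k)) hu (κ.layerSubgroup n)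
        (layerSubgroup_le_unitTwist_layerSubgroup_of_le hn) (κ.isOpen_layerSubgroup n) (D.proj n s k) := by
  have : hF = κ.fintypeQuotientLayer n := Subsingleton.elim _ _
  subst this
  rfl

omit [V.IsElliptic] in
/-- **At `A = A_{m,k}` the generic component IS D1's `eisensteinComponent`** (definitionally).
[cite: Howard2004HeegnerKolyvagin, §2.2, Lemma 2.2.7 and Prop. 2.2.8] -/
theorem coeffComponent_eisenstein {m : ℕ} (hm : 1 ≤ m) (k n : ℕ) (hn : eisensteinLevel (p := p) hm k ≤ n) :
    D.coeffComponent (ZpExtension.onePlusT_pow_prime_pow_eisensteinLevel (p := p) hm k) k n hn =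
      D.eisensteinComponent hm k n hn :=
  rfl

/-- **Independence of the auxiliary layer**: for `J ≤ n ≤ n'`, `comp_{n'} = comp_n` (`coresCoeff_coresLe` and
`cor (proj n' s) = proj n s` on `𝔖_p(K_∞)` when `E(K)[p] = 0`, `coresLe_proj_eq_proj`).
[cite: Howard2004HeegnerKolyvagin, §2.2 (𝔖 = lim← H¹(K_n, T))] [cite: PerrinRiou1987BSMF, §0 p. 402] -/
theorem coeffComponent_eq_of_le (hγ : κ.IsTopGenerator γ) (hE : ∀ P : V.toAffine.Point, p • P = 0 → P = 0)
    (k : ℕ) {n n' : ℕ} (hn : J ≤ n) (hnn' : n ≤ n') (s : D.S) :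
    D.coeffComponent hu k n' (hn.trans hnn') s = D.coeffComponent hu k n hn s := by
  rcases hnn'.eq_or_lt with rfl | hlt
  · rfl
  haveI := κ.fintypeQuotientLayer n
  haveI := κ.fintypeQuotientLayer n'
  have hfin : ∀ j : ℕ, (κ.layerSubgroup j).FiniteIndex := fun j ↦
    ⟨by rw [κ.index_layerSubgroup j]; exact pow_ne_zero _ hp.out.ne_zero⟩
  haveI := hfin
  haveI : Fintype (κ.layerSubgroup n ⧸ (κ.layerSubgroup n').subgroupOf (κ.layerSubgroup n)) := Fintype.ofFinite _
  rw [coeffComponent_apply, coeffComponent_apply,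
    (κ.unitTwist (-1)).coresCoeff_coresLe (V.torsionGaloisModule ((p : ℤ) ^ k)) hu
      (layerSubgroup_le_unitTwist_layerSubgroup_of_le hn) (κ.layerSubgroup_antitone hnn')
      (κ.isOpen_layerSubgroup n) (κ.isOpen_layerSubgroup n'),
    D.coresLe_proj_eq_proj hγ hE k hlt]

/-- The value at the canonical layer `n = J`. [cite: Howard2004HeegnerKolyvagin, §2.2] -/
theorem coeffComponent_eq_self (hγ : κ.IsTopGenerator γ) (hE : ∀ P : V.toAffine.Point, p • P = 0 → P = 0)
    (k : ℕ) {n : ℕ} (hn : J ≤ n) (s : D.S) :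
    D.coeffComponent hu k n hn s = D.coeffComponent hu k J le_rfl s :=
  D.coeffComponent_eq_of_le hu hγ hE k le_rfl hn s

/-! ## §2 Compatibility with the change of coefficients and with the reductions -/

section Change

variable {A' : Type} [CommRing A'] {u' : A'} {J' : ℕ} (hu' : u' ^ (p ^ J') = 1) (φ : A →+* A') (hφ : φ u = u')

omit [NumberField K] [V.IsElliptic] hp in
/-- A morphism of discrete Galois modules which is pointwise the identity induces the identity on `H¹(N, ·)`.
[cite: SerreGaloisCohomology1997, I §2.2] -/
theorem cohomologyMap_subgroupRepHom_eq_self_of_forall_eq (k : ℕ)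
    (f : (V.torsionGaloisModule ((p : ℤ) ^ k)).toContRepresentation →ⁱL
      (V.torsionGaloisModule ((p : ℤ) ^ k)).toContRepresentation)
    (hf : ∀ P, f P = P) (N : Subgroup (absoluteGaloisGroup K)) (y : V.torsionH1Over ((p : ℤ) ^ k) N) :
    cohomologyMap (subgroupRepHom (TopRep.ofHom ⟨f.toContinuousLinearMap, f.isIntertwining'⟩) N) 1 y = y := by
  obtain ⟨ψ, rfl⟩ :=
    oneCocycleClass_surjective (subgroupRep (V.torsionGaloisModule ((p : ℤ) ^ k)).toTopRep N) y
  rw [cohomologyMap_oneCocycleClass]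
  refine congrArg _ (Subtype.ext (ContinuousMap.ext fun x ↦ ?_))
  rw [pullback_id_resIdHom_apply, subgroupRepHom_hom_apply]
  exact hf (ψ.1 x)

omit [V.IsElliptic] in
/-- **Pure change of coefficients**: for `φ : A → A′` with `φ u = u′` and a module map `f` which is pointwise
the identity (e.g. `ContIntertwiningMap.id`), `H¹(φ ⊗ f) ∘ comp_A = comp_{A′}` at every admissible layer `n`
(`map_coeffTwistReduce_coresCoeff`). [cite: Howard2004HeegnerKolyvagin, Rem. 1.2.4 (change of coefficient ring)]
[cite: SerreGaloisCohomology1997, I §2.4] -/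
theorem map_coeffTwistReduce_coeffComponent_of_forall_eq (k n : ℕ) (hn : J ≤ n) (hn' : J' ≤ n)
    (f : (V.torsionGaloisModule ((p : ℤ) ^ k)).toContRepresentation →ⁱL
      (V.torsionGaloisModule ((p : ℤ) ^ k)).toContRepresentation) (hf : ∀ P, f P = P) (s : D.S) :
    galoisCohomology.map ((κ.unitTwist (-1)).coeffTwistReduce hu hu' φ hφ f) 1 (D.coeffComponent hu k n hn s) =
      D.coeffComponent hu' k n hn' s := by
  haveI := κ.fintypeQuotientLayer n
  rw [coeffComponent_apply, coeffComponent_apply,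
    (κ.unitTwist (-1)).map_coeffTwistReduce_coresCoeff hu hu' φ hφ f (κ.layerSubgroup n)
      (layerSubgroup_le_unitTwist_layerSubgroup_of_le hn) (layerSubgroup_le_unitTwist_layerSubgroup_of_le hn')
      (κ.isOpen_layerSubgroup n),
    cohomologyMap_subgroupRepHom_eq_self_of_forall_eq k f hf]

omit [V.IsElliptic] in
/-- **Pure change of coefficients along the identity of `E[p^k]`**: `H¹(φ ⊗ 1) ∘ comp_A = comp_{A′}`.
[cite: Howard2004HeegnerKolyvagin, Rem. 1.2.4] -/
theorem map_coeffTwistReduce_id_coeffComponent (k n : ℕ) (hn : J ≤ n) (hn' : J' ≤ n) (s : D.S) :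
    galoisCohomology.map ((κ.unitTwist (-1)).coeffTwistReduce hu hu' φ hφ (ContIntertwiningMap.id)) 1
        (D.coeffComponent hu k n hn s) = D.coeffComponent hu' k n hn' s :=
  D.map_coeffTwistReduce_coeffComponent_of_forall_eq hu hu' φ hφ k n hn hn' _ (fun _ ↦ rfl) s

omit [V.IsElliptic] in
/-- **The source-to-target level map IS D1's control component**: for `φ : A → A_{m,k}` with `φ u = 1 + T`,
`H¹(φ ⊗ 1) ∘ comp_A = eisensteinComponent D hm k` (so, by `proj_toEisensteinH1`, its value on `z` is the `k`-th
projection of the compact control map `toEisensteinH1 z`) — the «`f k` literally a quotient map» hook of the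
Kolyvagin-system pushforward `one′ k = H¹(f k)(one (σ k))` at the Eisenstein prime.
[cite: Howard2004HeegnerKolyvagin, proof of Thm. 2.2.10 (arXiv Thm. 3.2.10, p0017 L78–81: KS(𝐓, F_Λ, 𝓛) → KS(T_𝔭, F_𝔭, 𝓛)) and Rem. 1.2.4] -/
theorem map_coeffTwistReduce_coeffComponent_eq_eisensteinComponent {m : ℕ} (hm : 1 ≤ m) (k n : ℕ)
    (hn : J ≤ n) (hn' : eisensteinLevel (p := p) hm k ≤ n) (φ : A →+* IwasawaAlgebra.EisensteinCoeff p m k)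
    (hφ : φ u = IwasawaAlgebra.EisensteinCoeff.onePlusT p m k) (s : D.S) :
    galoisCohomology.map ((κ.unitTwist (-1)).coeffTwistReduce hu
        (ZpExtension.onePlusT_pow_prime_pow_eisensteinLevel (p := p) hm k) φ hφ (ContIntertwiningMap.id)) 1
        (D.coeffComponent hu k n hn s) = D.eisensteinComponent hm k n hn' s :=
  D.map_coeffTwistReduce_id_coeffComponent hu _ φ hφ k n hn hn' s

variable (t : ∀ k, (V.torsionGaloisModule ((p : ℤ) ^ (k + 1))).toContRepresentation →ⁱL
  (V.torsionGaloisModule ((p : ℤ) ^ k)).toContRepresentation)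
  (ht : ∀ k (P : geomTorsion V ((p : ℤ) ^ (k + 1))), t k P = V.geomTorsionReduce p k P)

include ht

omit [V.IsElliptic] in
/-- **Compatibility with the tower transitions `E[p^{k+1}] ⊗ A(χ_u) → E[p^k] ⊗ A′(χ_{u′})`**: for `n` above `J` and
`J′`, `H¹(φ ⊗ t k) (comp_{A,k+1,n} s) = comp_{A′,k,n} s` — naturality of `coresCoeff` (`map_coeffTwistReduce_coresCoeff`)
and the `p`-compatibility `p_* (proj n s)_{k+1} = (proj n s)_k` of `S_p(E/K_n)` (`mem_compactSelmerOver_iff`). With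
`φ = id` these are the reductions inside one coefficient ring; with `φ : Λ/I_{k+1} ↠ Λ/I_k` the transitions of the
Λ-adic source tower. [cite: Howard2004HeegnerKolyvagin, §2.2 and Def. 2.2.3] [cite: PerrinRiou1987BSMF, §0 p. 401] -/
theorem map_coeffTwistReduce_coeffComponent_reduce (k n : ℕ) (hn : J ≤ n) (hn' : J' ≤ n) (s : D.S) :
    galoisCohomology.map ((κ.unitTwist (-1)).coeffTwistReduce hu hu' φ hφ (t k)) 1
        (D.coeffComponent hu (k + 1) n hn s) = D.coeffComponent hu' k n hn' s := by
  haveI := κ.fintypeQuotientLayer n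
  rw [coeffComponent_apply, coeffComponent_apply,
    (κ.unitTwist (-1)).map_coeffTwistReduce_coresCoeff hu hu' φ hφ (t k) (κ.layerSubgroup n)
      (layerSubgroup_le_unitTwist_layerSubgroup_of_le hn) (layerSubgroup_le_unitTwist_layerSubgroup_of_le hn')
      (κ.isOpen_layerSubgroup n),
    cohomologyMap_subgroupRepHom_eq_reduceTorsionH1 t ht,
    ((V.mem_compactSelmerOver_iff (κ.layerSubgroup n) p (D.proj n s)).1 (D.proj_mem n s)).2 k]

/-- **Compatibility at the canonical layers** (each component at its own layer `J`, `J′`; the shape consumed by a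
tower's `limitH1`). [cite: Howard2004HeegnerKolyvagin, §2.2 and Def. 2.2.3] -/
theorem map_coeffTwistReduce_coeffComponent_reduce_self (hγ : κ.IsTopGenerator γ)
    (hE : ∀ P : V.toAffine.Point, p • P = 0 → P = 0) (k : ℕ) (s : D.S) :
    galoisCohomology.map ((κ.unitTwist (-1)).coeffTwistReduce hu hu' φ hφ (t k)) 1
        (D.coeffComponent hu (k + 1) J le_rfl s) = D.coeffComponent hu' k J' le_rfl s := by
  rw [← D.coeffComponent_eq_self hu hγ hE (k + 1) (le_max_left J J'),
    D.map_coeffTwistReduce_coeffComponent_reduce hu hu' φ hφ t ht k _ (le_max_left _ _) (le_max_right _ _),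
    D.coeffComponent_eq_self hu' hγ hE k]

end Change

end WeierstrassCurve.LambdaAdicSelmerData

end
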